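/- Width seat `ym-line-cbag-p1-w2` (prover-ym-line-cbag-p1-w2-g14-0) on the planner-of-record's LINE 6, route `SmallBetaInfraredSplit` (sub QCD):
REGISTERED STUB 1 `stub_floorZero` of the birth skeleton of crux `NeighbourFloorSmallBeta` (stmt-QuantumFields-27241), BY NAME — the `β = 0`,
`C = 0` case of the crux (Salmhofer–Seiler's Schwinger–Dyson lower bound (4.38) at `m = 0`, at the gauge level).  RECORD-rung material
(LADDER-YM Q1, QCD side); nothing about `β > 0`, a mass gap, the continuum or any summit is proved here; the crux stays open (stub 2
`stub_floorLipschitz` is the research content). -/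
import Summits.QuantumFields.QCD.Theorems.SmallBetaInfraredSplitZeroCouplingDictionary
import Literature.MathematicalPhysics.StatisticalMechanics.ComplexSpinChiralLRO
import HarnessLib

/-!
# Crux `NeighbourFloorSmallBeta` (stmt-QuantumFields-27241), stub 1: `stub_floorZero` — the Schwinger–Dyson floor at `β = 0`

For `1 ≤ N ≤ 4`, `ν ≥ 4` and every even torus of side `L ≥ 2`:
`(2N)² / K(N) ≤ |Λ|⁻¹ Σ_x Σ_μ (G_0(x, x+e_μ) + G_0(x, x−e_μ))`, `K(N) = sdK N (uNLogCoeff N)`, where `G_0` is the gauge two-point function at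
`β = 0`, `m = 0` in the determinant / propagator representation (verbatim the crux's form).  Proof: at every site `x`, the tree's Schwinger–Dyson
bound `ComplexSpin.partitionFunction_le_sd` (SS91 (4.38) at `m = 0`: `Z_Λ ≤ K(N) Σ_{|y−x|=1} [σ_xσ_y]_Λ`, hypotheses `hasLog_uN`,
`uNLogCoeff_nonneg` for `N ≤ 4`) and `Z_Λ > 0` (`partitionFunction_pos`) give `1/K(N) ≤ Σ_μ (⟨σ_xσ_{x+e_μ}⟩ + ⟨σ_xσ_{x−e_μ}⟩)`; average over
`x` and multiply by the `β = 0` dictionary `G_0 = (2N)²⟨σσ⟩` (`detRep_eq_sq_mul_expect`).  [SalmhoferSeiler1991, (4.38), (2.21), Remark 4.10(1)]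
-/

set_option autoImplicit false

noncomputable section

namespace Summit.QuantumFields.QCD.Theorems.SmallBetaInfraredSplit

open MeasureTheory
open Literature.Probability.LatticeModels (TorusSite)
open Literature.MathematicalPhysics.QuantumFieldTheory
open Literature.MathematicalPhysics.QuantumLattice
open Literature.MathematicalPhysics.QuantumLattice.StrongCoupling
open Literature.MathematicalPhysics.QuantumLattice.StaggeredSingular (D0)
open Literature.MathematicalPhysics.StatisticalMechanics
open Literature.MathematicalPhysics.StatisticalMechanics.ComplexSpin

/-- **The complex-spin Schwinger–Dyson floor at `m = 0`, normalised, at every site**: for the `U(N)` bond data with `1 ≤ N ≤ 4` on an even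
torus of side `L ≥ 2` (`ν ≥ 1`), `1/K(N) ≤ Σ_μ (⟨σ_xσ_{x+e_μ}⟩_Λ + ⟨σ_xσ_{x−e_μ}⟩_Λ)` (SS91 (4.38) divided by `Z_Λ > 0`).
[cite: SalmhoferSeiler1991, Thm. 4.8 (4.38)] -/
theorem inv_sdK_le_sum_nbr_expect {ν L N : ℕ} [NeZero L] (hN1 : 1 ≤ N) (hN4 : N ≤ 4) (hν : 1 ≤ ν) (hE : Even L) (hL2 : 2 ≤ L)
    (x : TorusSite ν L) :
    1 / sdK N (uNLogCoeff N) ≤ ∑ μ : Fin ν,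
      (expect N 0 (uNBondCoeff N) (MvPolynomial.X x * MvPolynomial.X (x + Pi.single μ 1)) +
        expect N 0 (uNBondCoeff N) (MvPolynomial.X x * MvPolynomial.X (x - Pi.single μ 1))) := by
  have hlog := hasLog_uN hN1 hN4
  have hw : ∀ k, 2 ≤ k → k ≤ N → 0 ≤ uNLogCoeff N k := fun k hk2 hkN => uNLogCoeff_nonneg hN4 k hk2 hkN
  have hw' : ∀ k, 1 ≤ k → k ≤ N → 0 ≤ uNLogCoeff N k := by
    intro k hk1 hkN
    rcases Nat.lt_or_ge k 2 with hk | hk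
    · rw [show k = 1 by omega, uNLogCoeff_one]; exact zero_le_one
    · exact hw k hk hkN
  have ha := hlog.coeff_nonneg (uNBondCoeff_zero N) hw'
  have hapos := hlog.coeff_pos hN1 (uNBondCoeff_zero N) (uNLogCoeff_one N) hw
  have hZ : 0 < partitionFunction (ν := ν) (L := L) N 0 (uNBondCoeff N) :=
    partitionFunction_pos hE.two_dvd hL2 hν le_rfl ha (hapos 0 (Nat.zero_le N)) (hapos N le_rfl)
  have hK1 : 1 ≤ sdK N (uNLogCoeff N) := one_le_sdK hN1 (uNLogCoeff_one N) hw
  have hKpos : 0 < sdK N (uNLogCoeff N) := by linarith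
  -- (4.38) at `m = 0`
  have h38 := partitionFunction_le_sd hN1 hlog (uNBondCoeff_zero N) (uNLogCoeff_one N) hw hL2 (le_refl (0 : ℝ)) x
  rw [mul_zero, zero_mul, zero_add] at h38
  have hsum : ∑ s : Fin ν × Bool, bracket N 0 (uNBondCoeff N) (MvPolynomial.X x * MvPolynomial.X (nbr x s)) =
      ∑ μ : Fin ν, (bracket N 0 (uNBondCoeff N) (MvPolynomial.X x * MvPolynomial.X (x + Pi.single μ 1)) +
        bracket N 0 (uNBondCoeff N) (MvPolynomial.X x * MvPolynomial.X (x - Pi.single μ 1))) := by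
    rw [Fintype.sum_prod_type]
    refine Finset.sum_congr rfl fun μ _ => ?_
    rw [Fintype.sum_bool]
    simp [nbr]
  rw [hsum] at h38
  -- divide by `Z_Λ`
  simp_rw [expect_eq_div, ← add_div]
  rw [← Finset.sum_div, div_le_div_iff₀ hKpos hZ, one_mul]
  linarith [h38]

/-- **STUB 1 of the registered skeleton of crux `NeighbourFloorSmallBeta` (stmt-QuantumFields-27241), proved: the Schwinger–Dyson
nearest-neighbour floor `(2N)²/K(N) ≤ |Λ|⁻¹ Σ_x Σ_μ (G_0(x,x+e_μ) + G_0(x,x−e_μ))` at `β = 0`, `m = 0` on every even torus of side `≥ 2`**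
(`L₀ = 2`) — SS91 (4.38) at every site, `Z_Λ > 0`, averaged, and the `β = 0` dictionary `G_0 = (2N)²⟨σσ⟩_Λ`.  NOT the crux (`β > 0` is
stub 2); nothing about a mass gap. -/
theorem stub_floorZero : ∀ N ν : ℕ, 1 ≤ N → N ≤ 4 → 4 ≤ ν → ∃ L₀ : ℕ, ∀ (L : ℕ) [NeZero L], Even L → L₀ ≤ L → (2 * N : ℝ) ^ 2 * (1 / Literature.MathematicalPhysics.StatisticalMechanics.ComplexSpin.sdK N (Literature.MathematicalPhysics.StatisticalMechanics.ComplexSpin.uNLogCoeff N)) ≤ ((L : ℝ) ^ ν)⁻¹ * ∑ x : Literature.Probability.LatticeModels.TorusSite ν L, ∑ μ : Fin ν, ((MeasureTheory.integral (Literature.MathematicalPhysics.QuantumFieldTheory.wilsonWeight (d := ν) (L := L) (Literature.MathematicalPhysics.QuantumLattice.unitaryFundamentalRep (Fin N) ℂ) 0) (fun U => (Matrix.det (Literature.MathematicalPhysics.QuantumLattice.staggeredDirac (Literature.MathematicalPhysics.QuantumLattice.unitaryFundamentalRep (Fin N) ℂ) U 0)).re * (let G := (Literature.MathematicalPhysics.QuantumLattice.staggeredDirac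 (Literature.MathematicalPhysics.QuantumLattice.unitaryFundamentalRep (Fin N) ℂ) U 0)⁻¹; ((∑ a : Fin N, G (x, a) (x, a)) * (∑ b : Fin N, G ((x + Pi.single μ 1), b) ((x + Pi.single μ 1), b)) - ∑ a : Fin N, ∑ b : Fin N, G (x, a) ((x + Pi.single μ 1), b) * G ((x + Pi.single μ 1), b) (x, a)).re)) / MeasureTheory.integral (Literature.MathematicalPhysics.QuantumFieldTheory.wilsonWeight (d := ν) (L := L) (Literature.MathematicalPhysics.QuantumLattice.unitaryFundamentalRep (Fin N) ℂ) 0) (fun U => (Matrix.det (Literature.MathematicalPhysics.QuantumLattice.staggeredDirac (Literature.MathematicalPhysics.QuantumLattice.unitaryFundamentalRep (Fin N) ℂ) U 0)).re)) + (MeasureTheory.integral (Literature.MathematicalPhysics.QuantumFieldTheory.wilsonWeight (d := ν) (L := L) (Literature.MathematicalPhysics.QuantumLattice.unitaryFundamentalRep (Fin N) ℂ) 0) (fun U => (Matrix.det (Literature.MathematicalPhysics.QuantumLattice.staggeredDirac (Literature.MathematicalPhysics.QuantumLattice.unitaryFundamentalRep (Fin N) ℂ) U 0)).re * (let G := (Literature.MathematicalPhysics.QuantumLattice.staggeredDirac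 (Literature.MathematicalPhysics.QuantumLattice.unitaryFundamentalRep (Fin N) ℂ) U 0)⁻¹; ((∑ a : Fin N, G (x, a) (x, a)) * (∑ b : Fin N, G ((x - Pi.single μ 1), b) ((x - Pi.single μ 1), b)) - ∑ a : Fin N, ∑ b : Fin N, G (x, a) ((x - Pi.single μ 1), b) * G ((x - Pi.single μ 1), b) (x, a)).re)) / MeasureTheory.integral (Literature.MathematicalPhysics.QuantumFieldTheory.wilsonWeight (d := ν) (L := L) (Literature.MathematicalPhysics.QuantumLattice.unitaryFundamentalRep (Fin N) ℂ) 0) (fun U => (Matrix.det (Literature.MathematicalPhysics.QuantumLattice.staggeredDirac (Literature.MathematicalPhysics.QuantumLattice.unitaryFundamentalRep (Fin N) ℂ) U 0)).re))) := by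
  intro N ν hN1 hN4 hν
  refine ⟨2, fun L _ hE hL2 => ?_⟩
  have hL1 : 1 < L := by omega
  have hν1 : 1 ≤ ν := by omega
  have hLpos : (0 : ℝ) < (L : ℝ) ^ ν := by positivity
  have hpos : (0 : ℝ) ≤ (2 * N : ℝ) ^ 2 := by positivity
  -- the floor at every site, in the determinant representation
  have hsite : ∀ x : TorusSite ν L, (2 * N : ℝ) ^ 2 * (1 / sdK N (uNLogCoeff N)) ≤ ∑ μ : Fin ν,
      ((∫ U, ((D0 U).det).re * (wick2 (D0 U)⁻¹ x (x + Pi.single μ 1)).re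
            ∂(wilsonWeight (d := ν) (L := L) (unitaryFundamentalRep (Fin N) ℂ) 0)) /
          (∫ U, ((D0 U).det).re ∂(wilsonWeight (d := ν) (L := L) (unitaryFundamentalRep (Fin N) ℂ) 0)) +
        (∫ U, ((D0 U).det).re * (wick2 (D0 U)⁻¹ x (x - Pi.single μ 1)).re
            ∂(wilsonWeight (d := ν) (L := L) (unitaryFundamentalRep (Fin N) ℂ) 0)) /
          (∫ U, ((D0 U).det).re ∂(wilsonWeight (d := ν) (L := L) (unitaryFundamentalRep (Fin N) ℂ) 0))) := by
    intro x
    have h := inv_sdK_le_sum_nbr_expect hN1 hN4 hν1 hE hL2 x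
    have e : ∑ μ : Fin ν,
        ((∫ U, ((D0 U).det).re * (wick2 (D0 U)⁻¹ x (x + Pi.single μ 1)).re
              ∂(wilsonWeight (d := ν) (L := L) (unitaryFundamentalRep (Fin N) ℂ) 0)) /
            (∫ U, ((D0 U).det).re ∂(wilsonWeight (d := ν) (L := L) (unitaryFundamentalRep (Fin N) ℂ) 0)) +
          (∫ U, ((D0 U).det).re * (wick2 (D0 U)⁻¹ x (x - Pi.single μ 1)).re
              ∂(wilsonWeight (d := ν) (L := L) (unitaryFundamentalRep (Fin N) ℂ) 0)) /
            (∫ U, ((D0 U).det).re ∂(wilsonWeight (d := ν) (L := L) (unitaryFundamentalRep (Fin N) ℂ) 0))) =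
        (2 * N : ℝ) ^ 2 * ∑ μ : Fin ν,
          (expect N 0 (uNBondCoeff N) (MvPolynomial.X x * MvPolynomial.X (x + Pi.single μ 1)) +
            expect N 0 (uNBondCoeff N) (MvPolynomial.X x * MvPolynomial.X (x - Pi.single μ 1))) := by
      rw [Finset.mul_sum]
      refine Finset.sum_congr rfl fun μ _ => ?_
      rw [detRep_eq_sq_mul_expect hN1 hν1 hE hL1, detRep_eq_sq_mul_expect hN1 hν1 hE hL1]
      ring
    rw [e]
    exact mul_le_mul_of_nonneg_left h hpos
  -- average over the sites
  have hcard : (Finset.univ : Finset (TorusSite ν L)).card = L ^ ν := by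
    rw [Finset.card_univ, Fintype.card_fun, ZMod.card, Fintype.card_fin]
  have hsum := Finset.sum_le_sum fun x (_ : x ∈ (Finset.univ : Finset (TorusSite ν L))) => hsite x
  rw [Finset.sum_const, hcard, nsmul_eq_mul, Nat.cast_pow] at hsum
  have key : (2 * N : ℝ) ^ 2 * (1 / sdK N (uNLogCoeff N)) ≤ ((L : ℝ) ^ ν)⁻¹ * ∑ x : TorusSite ν L, ∑ μ : Fin ν,
      ((∫ U, ((D0 U).det).re * (wick2 (D0 U)⁻¹ x (x + Pi.single μ 1)).re
            ∂(wilsonWeight (d := ν) (L := L) (unitaryFundamentalRep (Fin N) ℂ) 0)) /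
          (∫ U, ((D0 U).det).re ∂(wilsonWeight (d := ν) (L := L) (unitaryFundamentalRep (Fin N) ℂ) 0)) +
        (∫ U, ((D0 U).det).re * (wick2 (D0 U)⁻¹ x (x - Pi.single μ 1)).re
            ∂(wilsonWeight (d := ν) (L := L) (unitaryFundamentalRep (Fin N) ℂ) 0)) /
          (∫ U, ((D0 U).det).re ∂(wilsonWeight (d := ν) (L := L) (unitaryFundamentalRep (Fin N) ℂ) 0))) := by
    rw [le_inv_mul_iff₀ hLpos]
    exact hsum
  exact key

end Summit.QuantumFields.QCD.Theorems.SmallBetaInfraredSplit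

end
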